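import Summits.HubbardSuperconductivity.HubbardSuperconductivity.Theorems.AnisotropyChordInsertionEntropyLandauLink

/-!
# Route `AnisotropyChord` / H0 rotor rung: the entropy route — HYPOTHESIS (K₂), the COMPRESSIBILITY LOWER
# BOUND in inverse-free variational form (typed), and the named links `(Λ_α) ∧ (K₂) ⇒ (IR_α)`,
# `H1 ∧ (Λ_α) ∧ (K₂) ∧ (S ≤ S_max) ⇒ BEC`

Theory seat hubbard-h0-rotor-theory-1, memo ROTOR-THEORY-7 §92–§93/§100 (architecture v2): «(IR_α) ⟸[LEMMA M]
(K₂: `χ_L(k) ≥ χ₀`, compressibility as a LOWER bound) ∧ (Λ_α)».  The static susceptibility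
`χ_L(k) = (2/P)⟨ρ_{−k}ψ, (H − E₀)⁻¹ ρ_{−k}ψ⟩` is typed WITHOUT an operator inverse through the variational principle
`⟨φ, A⁻¹φ⟩ = sup_η (2Re⟨η, φ⟩ − ⟨η, Aη⟩)` (`A = H − E₀ > 0` on the momentum-`k` part of the sector): a lower bound
`χ_L(k) ≥ 2χ₀` is exactly the existence of a TRIAL STATE `η` of lattice momentum `k` in the sector with
`2Re⟨η, ψ conj ρ_k⟩ − ⟨η, (H − E₀)η⟩ ≥ χ₀ P`.  Compressibility sum rule: `χ_L(k) → n²κ`-normalised compressibility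
as `k → 0`, so (K₂) is «(K) from below», uniform in `L` and `k ≠ 0`.

* `CompressibilityLowerBound Δ M` — (K₂) for the reference sector `M − 1` (typed; physics hypothesis);
* `infraredStructureBound_of_landauGap_of_compressibility` — `(Λ_α) ∧ (K₂) ⇒ (IR_α)` (proved link, by
  `infraredStructureBound_of_landauGap`);
* `eventualCondensate_of_onebody_landau_compressibility` — `H1 ∧ (Λ_α) ∧ (K₂) ∧ (S ≤ S_max) ⇒ BEC`.
-/

set_option linter.dupNamespace false

noncomputable section

open Matrix Finset Filter Topology Complex
open scoped ComplexConjugate Real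
open Literature.MathematicalPhysics.QuantumLattice Literature.Probability.LatticeModels

namespace Summit.HubbardSuperconductivity.HubbardSuperconductivity.Theorems.AnisotropyChord.InsertionEntropy

/-- **HYPOTHESIS (K₂) — `CompressibilityLowerBound` (compressibility as a LOWER bound, variational form; typed).**
There is `χ₀ > 0` such that, eventually in `L`, for every Perron reference amplitude `ψ` (sector `M_L − 1`,
`P = L²/2 + M_L − 1` particles, sector energy `E₀`) and every `k ≠ 0` some trial vector `η` in the sector, of
lattice momentum `k`, has `2 Re⟨η, ψ conj ρ_k⟩ − (Re⟨η, Hη⟩ − E₀‖η‖²) ≥ χ₀ P` — equivalently (variational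
principle for `(H − E₀)⁻¹` on the momentum sector) the static susceptibility obeys `χ_L(k) ≥ 2χ₀`, uniformly in
`L` and `k ≠ 0`.  Physics input, not claimed: it is the lower half of hypothesis (K) of H0 («compressibility»),
cf. `E-CONV` (`xxzSectorEnergyConvex_holds`) for the SIGN of `κ`.
[conjecture: theory seat hubbard-h0-rotor-theory-1, cycle 7, 2026-08-28 — memo ROTOR-THEORY-7 §92–§93 hypothesis (K₂), variational typing by the prover seat hubbard-h0-rotor-p1 g9] -/
def CompressibilityLowerBound (Δ : ℝ) (M : ℕ → ℝ) : Prop :=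
  ∃ χ₀ > (0 : ℝ), ∀ᶠ L : ℕ in atTop, ∀ [NeZero L],
    ∀ aM : TensorIndex (TorusSite 2 L) 2 → ℝ, IsPerronSectorGroundAmplitude L Δ (M L - 1) aM →
      ∀ k : TorusSite 2 L, k ≠ 0 → ∃ η : TensorIndex (TorusSite 2 L) 2 → ℂ,
        η ∈ spinZSector (Λ := TorusSite 2 L) 1 (M L - 1) ∧
        (∀ v, (fun σ => η (shiftConfig L v σ)) = torusPhase L k v • η) ∧
        χ₀ * ((L : ℝ) ^ 2 / 2 + (M L - 1)) ≤
          2 * (∑ σ, conj (η σ) *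
              ((aM σ : ℂ) * conj (∑ s, if σ s = 0 then torusPhase L k s else 0))).re
            - ((∑ σ, conj (η σ) * ((xxzHamiltonian 1 (torusGraph 2 L) (-1) Δ).mulVec η) σ).re
                - lowestEnergyInSector 1 (xxzHamiltonian 1 (torusGraph 2 L) (-1) Δ) (M L - 1)
                    * ∑ σ, ‖η σ‖ ^ 2)

/-- **LINK (PROVED): `(Λ_α) ∧ (K₂) ⇒ (IR_α)`** for the reference sector, given eventually `P > 0`
(theory seat memo ROTOR-THEORY-7 §92–§93, LEMMA M in variational form). [folklore] -/
theorem infraredStructureBound_of_landauGap_of_compressibility (Δ : ℝ) (M : ℕ → ℝ)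
    (hΛ : LandauGapBound Δ (fun L => M L - 1)) (hK : CompressibilityLowerBound Δ M)
    (hP : ∀ᶠ L : ℕ in atTop, 0 < (L : ℝ) ^ 2 / 2 + (M L - 1)) :
    InfraredStructureBound Δ M :=
  infraredStructureBound_of_landauGap Δ M hΛ hK hP

/-- **LINK (PROVED): `H1 ∧ (Λ_α) ∧ (K₂) ∧ (S ≤ S_max) ⇒ BEC`** along a density sequence `→ ρ ∈ (0,1)` with
eventually non-trivial reference sectors (theory seat memo ROTOR-THEORY-7 §93/§100; the entropy route modulo
its physics hypotheses, every arrow kernel-checked). [folklore] -/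
theorem eventualCondensate_of_onebody_landau_compressibility (Δ : ℝ) (M : ℕ → ℝ) (ρ : ℝ)
    (hρ : ρ ∈ Set.Ioo (0 : ℝ) 1)
    (hlim : Tendsto (fun L : ℕ => 1 / 2 + M L / (L : ℝ) ^ 2) atTop (𝓝 ρ))
    (hsect : ∀ᶠ L : ℕ in atTop, ∀ [NeZero L], spinZSector (Λ := TorusSite 2 L) 1 (M L - 1) ≠ ⊥)
    (h1 : OneBodyInsertionStructure Δ M) (hΛ : LandauGapBound Δ (fun L => M L - 1))
    (hK : CompressibilityLowerBound Δ M) (hS : StructureFactorUpper Δ M) : EventualCondensate Δ M :=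
  eventualCondensate_of_onebody_landau Δ M ρ hρ hlim hsect h1 hΛ hK hS

end Summit.HubbardSuperconductivity.HubbardSuperconductivity.Theorems.AnisotropyChord.InsertionEntropy
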